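import Mathlib
import Literature.MathematicalPhysics.QuantumFieldTheory.Balaban1983to89.B12Ext436
import Literature.MathematicalPhysics.QuantumFieldTheory.Balaban1983to89.B12Decay510Lattice

/-!
# B12 §4 p.290 (4.36), (4.37) and (5.10) p.293 ON THE INFINITE LATTICE ℤᵈ: every geometric leaf of
`B12Ext436` DISCHARGED for the concrete class 𝐃⁰_j of localization domains of ℤᵈ (cubes of side M, sites =
lattice points, d_j = the tree length of `TreeLength`)

[cite: Balaban1987RG1 = T. Bałaban, *Renormalization group approach to lattice gauge field theories. I*, Commun. Math.
Phys. **109** (1987) 249–301; PDF page = journal page − 248.]  Companion modules (imported, none modified):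
`…Balaban1983to89.B12Ext436` (unit b03 gen 10: (4.36)/(4.37)/(5.10) on an ABSTRACT infinite `DomainClass` with an
abstract `SiteGeometry`, from the named leaves `DegreeLE`, `VolumeLeaf` (⇒ (1.26)), `GeomLeaf`, `CubeSumLeaf`,
`FarLeaf`, `KernelBound`), `…Balaban1983to89.B12Decay510Lattice` (unit b03 gen 4: the site lattice ℤᵈ with cubes of
side M — `cubeOf`, `proj`, `distCube`, `distCubeS` and their elementary inequalities — and the leaves of the FINITE
window systems), through them `…TreeLength` (`treeLen`, `card_le_treeLen`), `…TreeLengthCubeSystem` (`shift`,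
`exists_shift_of_adj`), `…B12Decay510Window` (`K₁`, the ℓ¹ lemmas), `…B12TreeDecay` (`kappa₀`, `K₀`),
`…B12Decay510` (`delta1`, `mixedDeriv`, `norm_mixedDeriv_le`), `…B13ScaleTransfer` (`Pt`, `Adj`, `FaceConnected`).

## CITATION HEADER (verbatim quotations, all already carried with the same locators by the two imported modules)

p.257: «We decompose the space T into the lattice of closed cubes of a size M, where M = Lᵐ» … «Such a domain is a
union of a connected, finite family of cubes from π_j. … A connected family means that for every pair □, □′ of cubes
from the family there exists a sequence □, □₁, …, □_n, □′ of cubes belonging to the family and such that two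
consecutive cubes have a common wall» … «A length of a shortest graph in this class, divided by M, is the linear size
of X, and is denoted by d_j(X).»  p.290: «We extend it to all X ∈ 𝐃⁰_j, where 𝐃⁰_j is the class of localization
domains constructed for the lattice ξZ⁴. … (4.36) ∣Σ_{X∈𝐃⁰_j, X∩(□̃²)ᶜ≠∅} 𝐄^{(2)}_{μ,ν}(X, x, y)∣ ≤ O(1)E₀
exp(−(L^jη)^{−1}) exp(−δ₁∣x − y∣), for x ∈ □».  p.291: «(4.37) Π_{μ,ν}(x, y) = Σ_{X∈𝐃⁰_j} 𝐄^{(2)}_{μ,ν}(X, x, y)».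
p.271: «(3.5) X∩(□̃²)ᶜ ≠ ∅, or X ⊂ □̃². Consider a domain X satisfying the first condition above. … There are two
cases possible, either X∩□̃ = ∅, or X∩□̃ ≠ ∅. In the first case dist(X, □) ≥ M, the distance is in the scale η,
hence in the scale ξ dist^{(ξ)}(X, □) ≥ M(L^jη)^{−1}. In the second case X is a big domain in ξ-scale, for example
d_j(X) ≥ (L^jη)^{−1}.»  p.293: «(5.10) … with a positive constant δ₁ determined by δ₀, κ, and M (e.g., δ₁ =
1/2min{δ₀, κM⁻¹})».  [II] = [cite: Balaban1988RG2Cluster] (1.26) p.8: «Σ_{X∈𝐃_j, X⊃□′} exp(−κd_j(X)) ≤ O(1), (1.26)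
for κ sufficiently large.»

## WHAT IS TYPED HERE ([folklore] lattice geometry; nothing of B12's analysis is asserted)

§1 THE CONCRETE CLASS 𝐃⁰_j OF ℤᵈ as a `B12Ext436.DomainClass` (`latt d`): cubes = ℤᵈ (`Pt d`), "common wall" =
`B13ScaleTransfer.Adj`, the 2d wall-neighbours (`nbrZ`), domains = the non-empty face-connected finite families
(`LDom d`, countably INFINITE), d_j := `TreeLength.treeLen`; the two inputs of (1.26) PROVED — `degreeLE_latt`
(Δ = 2d) and `volumeLeaf_latt` (∣X∣ ≤ 4·2ᵈ(1 + d_j(X)), from `card_le_treeLen`) — hence [II] (1.26) ON THE INFINITE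
LATTICE with no hypothesis on the geometry: `ineq126_latt`, `sum_exp_treeLen_le` (every finite family through a cube),
`summable_exp_treeLen` (the printed infinite sum: summable and ≤ K₀(4·2ᵈ, 2d), κ ≥ κ₀(4·2ᵈ, 2d)); the tree had this
only for finite windows (`TreeLengthCubeSystem.ineq126_treeLen`).
§2 THE CONCRETE SITE GEOMETRY (`geomOf`, `geomZ` = ℓ¹ reading, `geomZS` = sup reading): sites = ℤᵈ, cubes of side
M ≥ 1, dist(x, □) := `distCube` / `distCubeS`, dist(x, X) := the distance to a nearest cube of X (`near`), and the
leaves PROVED: `geomLeafZ` (∣x − y∣₁ ≤ dist(x, X) + dist(y, X) + Md(d_j(X) + 3)), `cubeSumLeafZ` (Σ_{□∈B}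
e^{−a dist(x,□)} ≤ K₁(d, a), every finite B, a > 0), `geomLeafZS` (sup: + M(d_j(X) + 3)), `cubeSumLeafZS` (K₁(d, a/d)).
§3 THE SEPARATION LEAF OF (4.36) PROVED (`farLeaf_of_separated`, abstract; `farLeafZ`, `farLeafZS` on ℤᵈ): reading
«X∩(□̃²)ᶜ ≠ ∅» as "X has a site in the outer region (□̃²)ᶜ" (`Meets`) and letting R := the separation of □ from
(□̃²)ᶜ (R ≤ ρ(x, q) for x ∈ □, q ∈ (□̃²)ᶜ — for print's cubes R = dist(□, (□̃²)ᶜ), of order M in the η-scale, i.e.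
M(L^jη)^{−1} in ξ-units), the two printed cases are ONE triangle inequality: R ≤ ρ(x, q) ≤ dist(x, X) + dist(q, X) +
M(d_j(X) + c₁) with dist(q, X) = 0, i.e. `FarLeaf` with constant R − Mc₁ — «either because the domains are large, or
because their distances to □ are large» (p.290).
§4 THE KERNEL BOUND from the analytic leaves over the infinite class (`kernelBound_of_analytic`: (4.4) analyticity on
the α₂-ball, (1.18), the representation of the r = 2 term (4.35) as the real part of the mixed τ-derivative
(`B12Decay510.mixedDeriv`) on the pair of minimizer responses, and their decay ∥h_X(x)∥ ≤ B₃e^{−δ₀dist(x,X)} (p.282) ⇒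
`KernelBound` with C_E = 4E₀α₂⁻²B₃², by `B12Decay510.norm_mixedDeriv_le`).
§5 THE CAPSTONES ON ℤᵈ with the kernel bound the ONLY remaining hypothesis: `ineq436_latt` ((4.36): for x ∈ □ the
family over {X ∈ 𝐃⁰_j : X∩(□̃²)ᶜ ≠ ∅} is summable and ∣Σ∣ ≤ C_E e^{3Mdδ₁} K₀ K₁(d, δ₀/4) e^{−(δ₁/2)(R − 3Md)}
e^{−δ₁∣x − y∣₁}, δ₁ = ½ min{δ₀, κ(Md)⁻¹}, κ ≥ 4κ₀), `twoPoint_latt` ((4.37) converges absolutely on 𝐃⁰_j and obeys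
(5.10) with δ₁ = ½ min{δ₀, κ(Md)⁻¹}, κ ≥ 2κ₀), `decay510_latt` (landing in `B12Sec2to5.Decay510` — (5.10) DIRECTLY on
ℤᵈ, with NO window-limit hypothesis, cf. `B12Decay510Lattice.decay510_lattice` which needed the limit (5.1)),
`decay510_latt_of_analytic` (the same from the analytic leaves of §4), and the sup-metric twins `ineq436_lattS`,
`ineq436_lattS_printed`, `twoPoint_lattS` in which the printed δ₁ = ½ min{δ₀, κM⁻¹} = `delta1 δ₀ κ M` appears ON
THE NOSE.

## DICTIONARY / DIVERGENCE (recorded in the cell file; closes D-b03.29 (i) and (iii) for this node)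

(i) 𝐃⁰_j of ξZᵈ ↦ `latt d`: the cubes of π_j are indexed by ℤᵈ, a site x of the unit ξ-lattice lies in the cube
⌊x/M⌋ (`cubeOf`); d_j := `treeLen` (tree length in cube units = «divided by M»; the sup-metric Steiner length of
`TreeLength`, whence the factor d of the ℓ¹ reading, exactly as in `B12Decay510Lattice` DIVERGENCE (i)).
(ii) «x ∈ □» ↦ x ∈ `Box` (any set of sites); «X∩(□̃²)ᶜ ≠ ∅» ↦ `MeetsZ M Outer X` := a site of a cube of X lies in
`Outer` (any set of sites); the cubes □̃ ⊂ □̃² of print (defined in the earlier papers of the series, by reference)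
enter ONLY through the separation number R of `Box` from `Outer`; print's R is M(L^jη)^{−1} (first case) and the
intermediate cube □̃ is not needed (the second case is absorbed by the diameter term M·d_j(X) of the geometry leaf).
(iii) Constants: c₁ = 3 and K₁ = K₁(d, ·) of `B12Decay510Window`/`B12Decay510Lattice`; K₀ = K₀(4·2ᵈ, 2d) of
`B12TreeDecay`; the budget of `B12Ext436` (domain count at κ/4 for (4.36), κ/2 for (5.10)).
(iv) ∣x − y∣ and dist^{(ξ)} read as ℓ¹ (`geomZ`, landing type `Decay510`) or as sup distances (`geomZS`, printed
δ₁), as in `B12Decay510Lattice` DIVERGENCE (i); print does not fix the lattice norm at these loci.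

## NOT TYPED / NOT CLAIMED

The kernel bound itself ((1.18), (4.4)–(4.5), the minimizer decay of p.282 / [15] Sect. G) — a hypothesis, or derived
in §4 from hypotheses; that the terms of (1.7) exist for domains of the infinite lattice; the r = 1 term of (4.3)
(handled for finite windows in `B12Decay510R1`, not re-typed over the infinite class); the cubes □̃ⁿ and the partition
ζ_□ of (3.4).  This module is a kernel certificate of elementary lattice geometry feeding the mechanism of
`B12Ext436`; it is NOT progress on any summit statement.
-/

namespace Literature.MathematicalPhysics.QuantumFieldTheory.Balaban1983to89.B12Ext436Lattice

open Literature.MathematicalPhysics.QuantumFieldTheory.Balaban1983to89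
open Literature.MathematicalPhysics.QuantumFieldTheory.Balaban1983to89.B13ScaleTransfer
open Literature.MathematicalPhysics.QuantumFieldTheory.Balaban1983to89.TreeLength (treeLen treeLen_nonneg card_le_treeLen)
open Literature.MathematicalPhysics.QuantumFieldTheory.Balaban1983to89.TreeLengthCubeSystem (shift exists_shift_of_adj)
open Literature.MathematicalPhysics.QuantumFieldTheory.Balaban1983to89.B12TreeDecay (kappa₀ K₀ kappa₀_nonneg K₀_pos)
open Literature.MathematicalPhysics.QuantumFieldTheory.Balaban1983to89.B12Decay510
  (delta1 delta1_le_half delta1_mul_le delta1_nonneg delta1_pos mixedDeriv norm_mixedDeriv_le)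
open Literature.MathematicalPhysics.QuantumFieldTheory.Balaban1983to89.B12Decay510Window
  (K₁ K₁_nonneg l1_neg l1_sub_comm l1_sub_triangle)
open Literature.MathematicalPhysics.QuantumFieldTheory.Balaban1983to89.B12Decay510Lattice
open Literature.MathematicalPhysics.QuantumFieldTheory.Balaban1983to89.B12Sec2to5 (l1 l1_nonneg Decay510)
open Literature.MathematicalPhysics.QuantumFieldTheory.Balaban1983to89.B12Ext436
open Literature.Probability.LatticeModels (IsRConnected)
open Set Metric Filter Topology

variable {d : ℕ}

/-! ## 1. The class 𝐃⁰_j of the infinite lattice ℤᵈ as a `DomainClass`; (1.26) on ℤᵈ -/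

/-- **The localization domains of the infinite lattice** (p.257: *"a union of a connected, finite family of cubes from
π_j"*; p.290: *"𝐃⁰_j is the class of localization domains constructed for the lattice ξZ⁴"*): the non-empty
face-connected finite families of cubes of ℤᵈ — a countably infinite type. [cite: Balaban1987RG1, §0 p.257 and §4 p.290] -/
abbrev LDom (d : ℕ) : Type := {X : Finset (Pt d) // X.Nonempty ∧ FaceConnected X}

/-- The wall-neighbours x ± e_i of a cube of ℤᵈ, as a finite list (the 2d shifts of `TreeLengthCubeSystem`). [folklore] -/
def nbrZ (a : Pt d) : Finset (Pt d) := Finset.univ.image (shift a)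

/-- Every cube with a common wall with `a` is in the list `nbrZ a`. [folklore] -/
theorem mem_nbrZ {a b : Pt d} (h : Adj a b) : b ∈ nbrZ a := by
  obtain ⟨p, hp⟩ := exists_shift_of_adj h
  exact Finset.mem_image.2 ⟨p, Finset.mem_univ _, hp.symm⟩

/-- A cube of ℤᵈ has at most 2d wall-neighbours ([Dimock2013] App. A counts paths of cubes this way).
[cite: Dimock2013, App. A Lemma 25 proof (arXiv:1108.1335v2 TeX L3119–3120)] -/
theorem card_nbrZ_le (a : Pt d) : (nbrZ a).card ≤ 2 * d :=
  calc (nbrZ a).card ≤ (Finset.univ : Finset (Fin d × Bool)).card := Finset.card_image_le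
    _ = 2 * d := by simp [Finset.card_univ, mul_comm]

/-- A non-empty face-connected family of cubes is `IsRConnected` for the wall adjacency (the chain of p.257 read in the
polymer-gas typing of `PolymerGasGeometric`). [cite: Balaban1987RG1, p.257 (localization domains)] -/
theorem isRConnected_of_faceConnected {X : Finset (Pt d)} (hX : X.Nonempty) (hc : FaceConnected X) :
    IsRConnected Adj X := by
  refine ⟨hX, fun v hv w hw => ?_⟩
  have h := hc v hv w hw
  clear hv hw
  unfold Linked at h
  induction h with
  | refl => exact Relation.ReflTransGen.refl
  | tail _ hbc ih =>
    obtain ⟨hb, hc', hadj⟩ := hbc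
    exact Relation.ReflTransGen.tail ih ⟨hadj, hb, hc'⟩

/-- **𝐃⁰_j of the infinite lattice ℤᵈ IS a `DomainClass`**: cubes ℤᵈ, common-wall adjacency, the 2d neighbours,
domains = non-empty face-connected finite families (a domain IS its family of cubes), d_j := the tree length
`treeLen` (*"A length of a shortest graph in this class, divided by M"*). [cite: Balaban1987RG1, §0 p.257 and §4 p.290] -/
noncomputable abbrev latt (d : ℕ) : DomainClass where
  Cube := Pt d
  Adj := Adj
  adj_symm := fun _ _ h => h.symm
  nbr := nbrZ
  mem_nbr := fun _ _ h => mem_nbrZ h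
  Dom := LDom d
  cubes := fun X => X.1
  cubes_injective := fun _ _ h => Subtype.ext h
  connected := fun X => isRConnected_of_faceConnected X.2.1 X.2.2
  dj := fun X => treeLen X.1
  dj_nonneg := fun X => treeLen_nonneg X.1

/-- d_j of the lattice class is the tree length. [folklore] -/
@[simp] theorem latt_dj (X : LDom d) : (latt d).dj X = treeLen X.1 := rfl

/-- The cubes of a domain of the lattice class are its members. [folklore] -/
@[simp] theorem latt_cubes (X : LDom d) : (latt d).cubes X = X.1 := rfl

/-- DEGREE BOUND, PROVED for ℤᵈ: `DegreeLE (2d)`. [folklore] -/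
theorem degreeLE_latt (d : ℕ) : (latt d).DegreeLE (2 * d) := fun a => card_nbrZ_le a

/-- THE VOLUME LEAF, PROVED for ℤᵈ: ∣X∣ ≤ 4·2ᵈ(1 + d_j(X)) for every localization domain of the infinite lattice
(`TreeLength.card_le_treeLen`: ∣X∣ ≤ 2ᵈ(4d_j(X) + 1), the repaired lower half of [II] (2.30) p.18).
[cite: Balaban1988RG2Cluster, (2.30) p.18 (lower half, repaired form)] -/
theorem volumeLeaf_latt (d : ℕ) : (latt d).VolumeLeaf (4 * 2 ^ d) := by
  intro X
  show ((X.1.card : ℕ) : ℝ) ≤ 4 * 2 ^ d * (1 + treeLen X.1)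
  have h := card_le_treeLen X.2.1 X.2.2
  have h2 : (0 : ℝ) ≤ 2 ^ d := by positivity
  nlinarith

/-- **[II] (1.26) ON THE INFINITE LATTICE ℤᵈ, NO HYPOTHESIS ON THE GEOMETRY**: for every κ ≥ κ₀(4·2ᵈ, 2d), every cube
□′ and every finite family of localization domains of ℤᵈ containing □′, Σ exp(−κd_j(X)) ≤ K₀(4·2ᵈ, 2d)
(`DomainClass.ineq126_of_volumeLeaf` on `degreeLE_latt`, `volumeLeaf_latt`). [cite: Balaban1988RG2Cluster, (1.26) p.8] -/
theorem ineq126_latt (d : ℕ) {κ : ℝ} (hκ : kappa₀ (4 * 2 ^ d) (2 * d) ≤ κ) :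
    (latt d).Ineq126 κ (K₀ (4 * 2 ^ d) (2 * d)) :=
  (latt d).ineq126_of_volumeLeaf (degreeLE_latt d) (volumeLeaf_latt d) hκ

/-- (1.26) on ℤᵈ spelled out over plain finite sets: for every cube c ∈ ℤᵈ, every κ ≥ κ₀(4·2ᵈ, 2d) and every finite
family F of non-empty face-connected finite X ∋ c, Σ_{X∈F} exp(−κ·treeLen X) ≤ K₀(4·2ᵈ, 2d).
[cite: Balaban1988RG2Cluster, (1.26) p.8] -/
theorem sum_exp_treeLen_le {κ : ℝ} (hκ : kappa₀ (4 * 2 ^ d) (2 * d) ≤ κ) (c : Pt d)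
    (F : Finset (Finset (Pt d))) (hF : ∀ X ∈ F, c ∈ X ∧ X.Nonempty ∧ FaceConnected X) :
    ∑ X ∈ F, Real.exp (-κ * treeLen X) ≤ K₀ (4 * 2 ^ d) (2 * d) := by
  classical
  have hfilter : F.filter (fun X => X.Nonempty ∧ FaceConnected X) = F :=
    Finset.filter_true_of_mem fun X hX => (hF X hX).2
  have h := ineq126_latt d hκ c (F.subtype fun X => X.Nonempty ∧ FaceConnected X)
    (fun X hX => (hF X.1 (Finset.mem_subtype.1 hX)).1)
  rw [← hfilter, ← Finset.subtype_map, Finset.sum_map]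
  simpa only [Function.Embedding.coe_subtype] using h

/-- **(1.26) on ℤᵈ AS THE PRINTED INFINITE SUM**: for κ ≥ κ₀(4·2ᵈ, 2d) and every cube □′, the family
X ↦ exp(−κd_j(X)) over {X ∈ 𝐃⁰_j : X ∋ □′} is summable and Σ′ ≤ K₀(4·2ᵈ, 2d) — *"≤ O(1) for κ sufficiently large"*,
the O(1) depending on d only. [cite: Balaban1988RG2Cluster, (1.26) p.8] -/
theorem summable_exp_treeLen {κ : ℝ} (hκ : kappa₀ (4 * 2 ^ d) (2 * d) ≤ κ) (c : Pt d) :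
    Summable (fun X : {X : LDom d // c ∈ X.1} => Real.exp (-κ * treeLen X.1.1)) ∧
    ∑' X : {X : LDom d // c ∈ X.1}, Real.exp (-κ * treeLen X.1.1) ≤ K₀ (4 * 2 ^ d) (2 * d) :=
  (latt d).summable_above (ineq126_latt d hκ) c

/-! ## 2. The site geometry of ℤᵈ with cubes of side M, and its leaves -/

/-- A cube of the domain X nearest to the site x, for a distance function δ, exists (X is non-empty and finite). [folklore] -/
theorem exists_near (δ : Pt d → Pt d → ℝ) (x : Pt d) (X : LDom d) :
    ∃ z ∈ X.1, ∀ z' ∈ X.1, δ x z ≤ δ x z' :=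
  Finset.exists_min_image X.1 (fun z => δ x z) X.2.1

/-- A chosen cube of X nearest to the site x (for the distance function δ). [folklore] -/
noncomputable def near (δ : Pt d → Pt d → ℝ) (x : Pt d) (X : LDom d) : Pt d :=
  Classical.choose (exists_near δ x X)

/-- The nearest cube belongs to the domain. [folklore] -/
theorem near_mem (δ : Pt d → Pt d → ℝ) (x : Pt d) (X : LDom d) : near δ x X ∈ X.1 :=
  (Classical.choose_spec (exists_near δ x X)).1

/-- The nearest cube minimizes the distance. [folklore] -/
theorem near_le (δ : Pt d → Pt d → ℝ) (x : Pt d) (X : LDom d) {z : Pt d} (hz : z ∈ X.1) :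
    δ x (near δ x X) ≤ δ x z :=
  (Classical.choose_spec (exists_near δ x X)).2 z hz

/-- **A `SiteGeometry` of the infinite lattice from a site-to-cube distance δ ≥ 0**: sites := ℤᵈ, dist(x, □) := δ,
dist(x, X) := δ to a nearest cube of X, `pick` := that cube. [cite: Balaban1987RG1, §0 p.257] -/
noncomputable def geomOf (δ : Pt d → Pt d → ℝ) (hδ : ∀ x z, 0 ≤ δ x z) : SiteGeometry (latt d) (Pt d) where
  distC := δ
  distD := fun x X => δ x (near δ x X)
  distC_nonneg := hδ
  distD_nonneg := fun x _ => hδ x _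
  pick := near δ
  pick_mem := fun x X => near_mem δ x X
  distC_pick_le := fun _ _ => le_rfl

/-- dist(x, X) of `geomOf`, unfolded. [folklore] -/
@[simp] theorem geomOf_distD (δ : Pt d → Pt d → ℝ) (hδ : ∀ x z, 0 ≤ δ x z) (x : Pt d) (X : LDom d) :
    (geomOf δ hδ).distD x X = δ x (near δ x X) := rfl

/-- dist(x, □) of `geomOf`, unfolded. [folklore] -/
@[simp] theorem geomOf_distC (δ : Pt d → Pt d → ℝ) (hδ : ∀ x z, 0 ≤ δ x z) (x c : Pt d) :
    (geomOf δ hδ).distC x c = δ x c := rfl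

/-- A site lying in a cube of X is at distance 0 from X, provided δ(p, ⌊p/M⌋) = 0. [folklore] -/
theorem geomOf_distD_eq_zero {δ : Pt d → Pt d → ℝ} (hδ : ∀ x z, 0 ≤ δ x z) {M : ℕ}
    (hself : ∀ p, δ p (cubeOf M p) = 0) {p : Pt d} {X : LDom d} (hp : cubeOf M p ∈ X.1) :
    (geomOf δ hδ).distD p X = 0 :=
  le_antisymm ((near_le δ p X hp).trans (le_of_eq (hself p))) (hδ p (near δ p X))

/-- **The geometry leaf for `geomOf`** from a symmetric ρ with the triangle inequality, attained distances
(ρ(x, proj_z x) ≤ δ(x, z), the clamped site lying in the cube z) and a site-level diameter bound ρ(p, q) ≤ M′(d_j(X) + c₁)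
for sites of X: ρ(x, y) ≤ dist(x, X) + dist(y, X) + M′(d_j(X) + c₁). [cite: Balaban1987RG1, §0 p.257] -/
theorem geomLeaf_geomOf {δ : Pt d → Pt d → ℝ} (hδ : ∀ x z, 0 ≤ δ x z) {ρ : Pt d → Pt d → ℝ} {M : ℕ}
    {M' c₁ : ℝ} (hM : 0 < M) (hsymm : ∀ a b, ρ a b = ρ b a) (htri : ∀ a b c, ρ a c ≤ ρ a b + ρ b c)
    (hatt : ∀ x z, ρ x (proj M z x) ≤ δ x z)
    (hdiam : ∀ (X : LDom d) (p q : Pt d), cubeOf M p ∈ X.1 → cubeOf M q ∈ X.1 →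
      ρ p q ≤ M' * (treeLen X.1 + c₁)) :
    (geomOf δ hδ).GeomLeaf ρ M' c₁ := by
  intro X x y
  show ρ x y ≤ δ x (near δ x X) + δ y (near δ y X) + M' * (treeLen X.1 + c₁)
  have hpx : cubeOf M (proj M (near δ x X) x) ∈ X.1 := by rw [cubeOf_proj hM]; exact near_mem δ x X
  have hpy : cubeOf M (proj M (near δ y X) y) ∈ X.1 := by rw [cubeOf_proj hM]; exact near_mem δ y X
  linarith [htri x (proj M (near δ x X) x) y, htri (proj M (near δ x X) x) (proj M (near δ y X) y) y,
    hsymm (proj M (near δ y X) y) y, hatt x (near δ x X), hatt y (near δ y X), hdiam X _ _ hpx hpy]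

/-- The unit-lattice sum behind the cube-sum leaf: Σ_{c∈B} e^{−b∣z − c∣₁} ≤ Σ_{w∈ℤᵈ} e^{−b∣w∣₁} = K₁(d, b) for b > 0,
every finite B ⊂ ℤᵈ and every z (`B12Sec2to5.summable_exp_neg_l1`). [folklore] -/
theorem sum_exp_l1_sub_le {b : ℝ} (hb : 0 < b) (z : Pt d) (B : Finset (Pt d)) :
    ∑ c ∈ B, Real.exp (-b * l1 (z - c)) ≤ K₁ d b := by
  have hs := B12Sec2to5.summable_exp_neg_l1 hb d
  calc ∑ c ∈ B, Real.exp (-b * l1 (z - c)) = ∑ w ∈ B.image (fun c => z - c), Real.exp (-b * l1 w) := by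
        rw [Finset.sum_image]
        intro p _ q _ h
        exact sub_right_injective h
    _ ≤ K₁ d b := hs.sum_le_tsum _ fun w _ => (Real.exp_pos _).le

/-- **The cube-sum leaf for `geomOf`**: if b∣⌊x/M⌋ − c∣₁ ≤ a·δ(x, c) for all sites x and cubes c (the key lower bound
of `B12Decay510Lattice`), then Σ_{c∈B} e^{−aδ(x,c)} ≤ K₁(d, b) for every finite B, uniformly in x.
[cite: Balaban1987RG1, (5.10) p.293] -/
theorem cubeSumLeaf_geomOf {δ : Pt d → Pt d → ℝ} (hδ : ∀ x z, 0 ≤ δ x z) {M : ℕ} {a b : ℝ} (hb : 0 < b)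
    (hkey : ∀ x c, b * l1 (cubeOf M x - c) ≤ a * δ x c) : (geomOf δ hδ).CubeSumLeaf a (K₁ d b) := by
  intro x B
  show ∑ c ∈ B, Real.exp (-a * δ x c) ≤ K₁ d b
  exact (Finset.sum_le_sum fun c _ => Real.exp_le_exp.2 (by linarith [hkey x c])).trans
    (sum_exp_l1_sub_le hb (cubeOf M x) B)

/-- **The ℓ¹ site geometry of ℤᵈ with cubes of side M** (p.257 cubes of size M; (5.10): sites x, y of the unit
lattice): dist(x, □) := the ℓ¹ lattice distance `distCube M` from the site to the cube, dist(x, X) := to a nearest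
cube of X. [cite: Balaban1987RG1, §0 p.257] -/
noncomputable def geomZ (d M : ℕ) : SiteGeometry (latt d) (Pt d) :=
  geomOf (distCube (d := d) M) (distCube_nonneg M)

/-- dist₁(p, ⌊p/M⌋) = 0: a site is at distance 0 from its own cube. [folklore] -/
theorem distCube_cubeOf {M : ℕ} (hM : 0 < M) (p : Pt d) : distCube M p (cubeOf M p) = 0 := by
  have h1 := distCube_le_l1_sub hM (rfl : cubeOf M p = cubeOf M p) p
  have h0 : l1 (p - p) = 0 := by simp [B12Sec2to5.l1]
  exact le_antisymm (h1.trans (le_of_eq h0)) (distCube_nonneg M p _)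

/-- In the ℓ¹ geometry a site of (a cube of) X is at distance 0 from X. [folklore] -/
theorem geomZ_distD_eq_zero {M : ℕ} (hM : 0 < M) {p : Pt d} {X : LDom d} (hp : cubeOf M p ∈ X.1) :
    (geomZ d M).distD p X = 0 :=
  geomOf_distD_eq_zero (distCube_nonneg M) (distCube_cubeOf hM) hp

/-- **Leaf (b), the geometry leaf, PROVED on ℤᵈ (ℓ¹ reading)**: ∣x − y∣₁ ≤ dist(x, X) + dist(y, X) + Md(d_j(X) + 3)
(the clamps into the nearest cubes attain the distances, `l1_sub_proj`; the site-level diameter bound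
`l1_sub_le_treeLen_sites`). [cite: Balaban1987RG1, §0 p.257] -/
theorem geomLeafZ {M : ℕ} (hM : 0 < M) : (geomZ d M).GeomLeaf (fun x y => l1 (x - y)) ((M : ℝ) * d) 3 :=
  geomLeaf_geomOf (distCube_nonneg M) hM (fun a b => l1_sub_comm a b) (fun a b c => l1_sub_triangle a b c)
    (fun x z => le_of_eq (l1_sub_proj hM z x))
    (fun X _ _ hp hq => l1_sub_le_treeLen_sites hM X.2.1 X.2.2 hp hq)

/-- **Leaf (c), the cube-sum leaf, PROVED on ℤᵈ with an M-uniform constant (ℓ¹ reading)**: for a > 0 and every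
finite set B of cubes, Σ_{□∈B} e^{−a·dist(x, □)} ≤ K₁(d, a) (dist(x, □_z) ≥ ∣⌊x/M⌋ − z∣₁, `l1_cubeOf_sub_le_distCube`).
[cite: Balaban1987RG1, (5.10) p.293] -/
theorem cubeSumLeafZ {M : ℕ} (hM : 0 < M) {a : ℝ} (ha : 0 < a) : (geomZ d M).CubeSumLeaf a (K₁ d a) :=
  cubeSumLeaf_geomOf (distCube_nonneg M) (M := M) ha fun x c =>
    mul_le_mul_of_nonneg_left (l1_cubeOf_sub_le_distCube hM x c) ha.le

/-- **The sup-metric site geometry of ℤᵈ with cubes of side M**: dist(x, □) := the sup lattice distance `distCubeS M`,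
dist(x, X) := to a nearest cube; with ∣x − y∣ := Mathlib's sup `dist` this is the reading in which the printed
δ₁ = ½ min{δ₀, κM⁻¹} appears literally. [cite: Balaban1987RG1, §0 p.257] -/
noncomputable def geomZS (d M : ℕ) : SiteGeometry (latt d) (Pt d) :=
  geomOf (distCubeS (d := d) M) (distCubeS_nonneg M)

/-- dist_∞(p, ⌊p/M⌋) = 0. [folklore] -/
theorem distCubeS_cubeOf {M : ℕ} (hM : 0 < M) (p : Pt d) : distCubeS M p (cubeOf M p) = 0 := by
  have h1 := distCubeS_le_dist hM (rfl : cubeOf M p = cubeOf M p) p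
  rw [dist_self] at h1
  exact le_antisymm h1 (distCubeS_nonneg M p _)

/-- In the sup geometry a site of (a cube of) X is at distance 0 from X. [folklore] -/
theorem geomZS_distD_eq_zero {M : ℕ} (hM : 0 < M) {p : Pt d} {X : LDom d} (hp : cubeOf M p ∈ X.1) :
    (geomZS d M).distD p X = 0 :=
  geomOf_distD_eq_zero (distCubeS_nonneg M) (distCubeS_cubeOf hM) hp

/-- **Leaf (b) in the sup metric, PROVED on ℤᵈ with the printed M**: dist_∞(x, y) ≤ dist_∞(x, X) + dist_∞(y, X) +
M(d_j(X) + 3) (`dist_le_treeLen_sites`). [cite: Balaban1987RG1, §0 p.257] -/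
theorem geomLeafZS {M : ℕ} (hM : 0 < M) : (geomZS d M).GeomLeaf dist (M : ℝ) 3 :=
  geomLeaf_geomOf (distCubeS_nonneg M) hM (fun a b => dist_comm a b) (fun a b c => dist_triangle a b c)
    (fun _ _ => le_rfl) (fun X _ _ hp hq => dist_le_treeLen_sites hM X.2.1 X.2.2 hp hq)

/-- **Leaf (c) in the sup metric, PROVED on ℤᵈ**: Σ_{□∈B} e^{−a·dist_∞(x, □)} ≤ K₁(d, a/d) for a > 0, d ≥ 1, every
finite B (∣⌊x/M⌋ − □∣₁ ≤ d·dist_∞(x, □), `l1_cubeOf_sub_le_mul_distCubeS`). [cite: Balaban1987RG1, (5.10) p.293] -/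
theorem cubeSumLeafZS (hd : 0 < d) {M : ℕ} (hM : 0 < M) {a : ℝ} (ha : 0 < a) :
    (geomZS d M).CubeSumLeaf a (K₁ d (a / d)) := by
  have hd' : (0 : ℝ) < d := Nat.cast_pos.2 hd
  refine cubeSumLeaf_geomOf (distCubeS_nonneg M) (M := M) (div_pos ha hd') fun x c => ?_
  have h := l1_cubeOf_sub_le_mul_distCubeS hM x c
  rw [div_mul_eq_mul_div, div_le_iff₀ hd']
  nlinarith [h, ha.le]

/-! ## 3. The separation leaf of (4.36), PROVED: the two cases of p.271 are one triangle inequality -/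

/-- «X∩(□̃²)ᶜ ≠ ∅» over an abstract site geometry: the domain X has a site (`mem q X`) in the outer region `Outer`
(= (□̃²)ᶜ). [cite: Balaban1987RG1, (3.5) p.271] -/
def Meets {G : DomainClass} {Λ : Type*} (mem : Λ → G.Dom → Prop) (Outer : Set Λ) (X : G.Dom) : Prop :=
  ∃ q, mem q X ∧ q ∈ Outer

/-- **The separation leaf DERIVED** (p.271: *"either X∩□̃ = ∅ … dist^{(ξ)}(X, □) ≥ M(L^jη)^{−1} … or … X is a big
domain in ξ-scale, for example d_j(X) ≥ (L^jη)^{−1}"*; p.290: *"either because the domains are large, or because their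
distances to □ are large"*): if □ (`Box`) and (□̃²)ᶜ (`Outer`) are R-separated (R ≤ ρ(x, q)), sites of X are at
distance 0 from X, and the geometry leaf holds with (M, c₁), then for x ∈ □ and X meeting (□̃²)ᶜ,
R − Mc₁ ≤ dist(x, X) + M·d_j(X) — `FarLeaf`.  Proof: R ≤ ρ(x, q) ≤ dist(x, X) + dist(q, X) + M(d_j(X) + c₁), dist(q, X) = 0.
[cite: Balaban1987RG1, (3.5) p.271 and (4.36) p.290] -/
theorem farLeaf_of_separated {G : DomainClass} {Λ : Type*} (Γ : SiteGeometry G Λ) {ρ : Λ → Λ → ℝ} {M c₁ : ℝ}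
    (hgeo : Γ.GeomLeaf ρ M c₁) (mem : Λ → G.Dom → Prop) (hmem : ∀ q X, mem q X → Γ.distD q X = 0)
    {Box Outer : Set Λ} {R : ℝ} (hsep : ∀ x ∈ Box, ∀ q ∈ Outer, R ≤ ρ x q) :
    Γ.FarLeaf (Meets mem Outer) Box M (R - M * c₁) := by
  intro X x hX hx
  obtain ⟨q, hq, hqO⟩ := hX
  have h1 := hgeo X x q
  rw [hmem q X hq] at h1
  have h2 := hsep x hx q hqO
  linarith

/-- The outer region as the complement of the open R-neighbourhood of □: {q : R ≤ ρ(x, q) for all x ∈ □} is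
R-separated from □ by definition (for print's cubes, (□̃²)ᶜ lies in this region with R = dist(□, (□̃²)ᶜ)). [folklore] -/
def outerOf {Λ : Type*} (ρ : Λ → Λ → ℝ) (Box : Set Λ) (R : ℝ) : Set Λ := {q | ∀ x ∈ Box, R ≤ ρ x q}

/-- `outerOf ρ Box R` is R-separated from `Box`. [folklore] -/
theorem outerOf_sep {Λ : Type*} (ρ : Λ → Λ → ℝ) (Box : Set Λ) (R : ℝ) :
    ∀ x ∈ Box, ∀ q ∈ outerOf ρ Box R, R ≤ ρ x q := fun x hx _ hq => hq x hx

/-- A sub-region of an R-separated region is R-separated (print's (□̃²)ᶜ ⊆ the complement of the R-neighbourhood of □).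
[folklore] -/
theorem sep_mono {Λ : Type*} {ρ : Λ → Λ → ℝ} {Box Outer Outer' : Set Λ} {R : ℝ} (hO : Outer' ⊆ Outer)
    (hsep : ∀ x ∈ Box, ∀ q ∈ Outer, R ≤ ρ x q) : ∀ x ∈ Box, ∀ q ∈ Outer', R ≤ ρ x q :=
  fun x hx q hq => hsep x hx q (hO hq)

/-- «X∩(□̃²)ᶜ ≠ ∅» on ℤᵈ with cubes of side M: some site of `Outer` lies in a cube of X. [cite: Balaban1987RG1, (3.5) p.271] -/
def MeetsZ (M : ℕ) (Outer : Set (Pt d)) (X : LDom d) : Prop := ∃ q, cubeOf M q ∈ X.1 ∧ q ∈ Outer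

/-- `MeetsZ` is `Meets` for the membership "the site lies in a cube of X". [folklore] -/
theorem meetsZ_eq (M : ℕ) (Outer : Set (Pt d)) :
    MeetsZ M Outer = Meets (G := latt d) (fun q X => cubeOf M q ∈ X.1) Outer := rfl

/-- **The separation leaf PROVED on ℤᵈ (ℓ¹ reading)**: if R ≤ ∣x − q∣₁ for x ∈ □ and q ∈ (□̃²)ᶜ, then for x ∈ □ and X
meeting (□̃²)ᶜ, R − 3Md ≤ dist(x, X) + Md·d_j(X). [cite: Balaban1987RG1, (3.5) p.271 and (4.36) p.290] -/
theorem farLeafZ {M : ℕ} (hM : 0 < M) {Box Outer : Set (Pt d)} {R : ℝ}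
    (hsep : ∀ x ∈ Box, ∀ q ∈ Outer, R ≤ l1 (x - q)) :
    (geomZ d M).FarLeaf (MeetsZ M Outer) Box ((M : ℝ) * d) (R - (M : ℝ) * d * 3) :=
  farLeaf_of_separated (geomZ d M) (geomLeafZ hM) (fun q X => cubeOf M q ∈ X.1)
    (fun _ _ hq => geomZ_distD_eq_zero hM hq) hsep

/-- **The separation leaf PROVED on ℤᵈ (sup reading, the printed M)**: if R ≤ dist_∞(x, q) for x ∈ □, q ∈ (□̃²)ᶜ, then
for x ∈ □ and X meeting (□̃²)ᶜ, R − 3M ≤ dist_∞(x, X) + M·d_j(X). [cite: Balaban1987RG1, (3.5) p.271 and (4.36) p.290] -/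
theorem farLeafZS {M : ℕ} (hM : 0 < M) {Box Outer : Set (Pt d)} {R : ℝ}
    (hsep : ∀ x ∈ Box, ∀ q ∈ Outer, R ≤ dist x q) :
    (geomZS d M).FarLeaf (MeetsZ M Outer) Box (M : ℝ) (R - (M : ℝ) * 3) :=
  farLeaf_of_separated (geomZS d M) (geomLeafZS hM) (fun q X => cubeOf M q ∈ X.1)
    (fun _ _ hq => geomZS_distD_eq_zero hM hq) hsep

/-! ## 4. The kernel bound over the infinite class from the analytic leaves ((4.4), (1.18), (4.35), p.282) -/

/-- **`KernelBound` DERIVED over the infinite class** (the ∞-analogue of `B12Decay510.kernelBound_of_repr435` with the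
Cauchy leaf discharged by `B12Decay510.norm_mixedDeriv_le`): IF 𝐄^{(j)}(X, ·) is analytic on the ball ‖𝐀‖ < α₂ ((4.4)
p.281) and bounded there by E₀e^{−κd_j(X)} ((1.18) p.263), the kernel is the real part of the mixed τ-derivative on the
pair of minimizer responses ((4.35) p.290 with (4.3) p.281), and the responses decay, ‖h_X(x)‖ ≤ B₃e^{−δ₀dist(x,X)}
(p.282), THEN ∣𝐄²(X, x, y)∣ ≤ 4E₀α₂⁻²B₃² e^{−κd_j(X)} e^{−δ₀dist(x,X)} e^{−δ₀dist(y,X)}. [cite: Balaban1987RG1, (4.5) p.282 and (4.35) p.290] -/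
theorem kernelBound_of_analytic {G : DomainClass} {Λ : Type*} (Γ : SiteGeometry G Λ) {W : Type*}
    [NormedAddCommGroup W] [NormedSpace ℂ W] (EX : G.Dom → W → ℂ) (h : G.Dom → Λ → W)
    (E2 : G.Dom → Λ → Λ → ℝ) {α₂ E₀ B₃ κ δ₀ : ℝ} (hα₂ : 0 < α₂) (hE₀ : 0 ≤ E₀) (hB₃ : 0 ≤ B₃)
    (han : ∀ X, AnalyticOnNhd ℂ (EX X) (ball 0 α₂))
    (h118 : ∀ X, ∀ v ∈ ball (0 : W) α₂, ‖EX X v‖ ≤ E₀ * Real.exp (-κ * G.dj X))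
    (hrepr : ∀ X x y, E2 X x y = (mixedDeriv (EX X) (h X x) (h X y)).re)
    (hh : ∀ X x, ‖h X x‖ ≤ B₃ * Real.exp (-δ₀ * Γ.distD x X)) :
    Γ.KernelBound E2 (4 * E₀ / α₂ ^ 2 * B₃ ^ 2) κ δ₀ := by
  intro X x y
  rw [hrepr]
  have h1 : |(mixedDeriv (EX X) (h X x) (h X y)).re| ≤
      4 * (E₀ * Real.exp (-κ * G.dj X)) / α₂ ^ 2 * ‖h X x‖ * ‖h X y‖ :=
    (Complex.abs_re_le_norm _).trans (norm_mixedDeriv_le hα₂ (han X) (h118 X) _ _)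
  have h0 : 0 ≤ 4 * (E₀ * Real.exp (-κ * G.dj X)) / α₂ ^ 2 := by positivity
  have e1 := hh X x
  have e2 := hh X y
  calc |(mixedDeriv (EX X) (h X x) (h X y)).re|
      ≤ 4 * (E₀ * Real.exp (-κ * G.dj X)) / α₂ ^ 2 * ‖h X x‖ * ‖h X y‖ := h1
    _ ≤ 4 * (E₀ * Real.exp (-κ * G.dj X)) / α₂ ^ 2 * (B₃ * Real.exp (-δ₀ * Γ.distD x X)) *
          (B₃ * Real.exp (-δ₀ * Γ.distD y X)) :=
        mul_le_mul (mul_le_mul_of_nonneg_left e1 h0) e2 (norm_nonneg _)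
          (mul_nonneg h0 (mul_nonneg hB₃ (Real.exp_nonneg _)))
    _ = 4 * E₀ / α₂ ^ 2 * B₃ ^ 2 * Real.exp (-κ * G.dj X) * Real.exp (-δ₀ * Γ.distD x X) *
          Real.exp (-δ₀ * Γ.distD y X) := by ring

/-! ## 5. (4.36), (4.37), (5.10) on ℤᵈ — the kernel bound the only remaining hypothesis -/

/-- κ ≥ t·κ₀(4·2ᵈ, 2d) with t > 0 forces κ ≥ 0. [folklore] -/
theorem kappa_nonneg_of {κ t : ℝ} (ht : 0 < t) (hκ₀ : kappa₀ (4 * 2 ^ d) (2 * d) ≤ κ / t) : 0 ≤ κ := by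
  have h0 := kappa₀_nonneg (c₀ := 4 * 2 ^ d) (by positivity) (2 * d)
  have h1 : 0 ≤ κ / t := h0.trans hκ₀
  have h2 : 0 * t ≤ κ := (le_div_iff₀ ht).1 h1
  linarith

/-- **(4.36) ON ℤᵈ (ℓ¹ reading), every geometric leaf discharged**: sites x, y ∈ ℤᵈ, cubes of side M ≥ 1, d ≥ 1; the
kernel bound ∣𝐄²(X, x, y)∣ ≤ C_E e^{−κd_j(X)}e^{−δ₀dist(x,X)}e^{−δ₀dist(y,X)} with δ₀ > 0 and κ ≥ 4κ₀(4·2ᵈ, 2d); □ = `Box`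
and (□̃²)ᶜ = `Outer` any sets of sites with R ≤ ∣x − q∣₁ for x ∈ □, q ∈ (□̃²)ᶜ.  Then for x ∈ □ the family
X ↦ 𝐄²(X, x, y) over {X ∈ 𝐃⁰_j : X∩(□̃²)ᶜ ≠ ∅} is summable and
∣Σ_{X∈𝐃⁰_j, X∩(□̃²)ᶜ≠∅} 𝐄²(X, x, y)∣ ≤ C_E e^{3Mdδ₁} K₀(4·2ᵈ, 2d) K₁(d, δ₀/4) · e^{−(δ₁/2)(R − 3Md)} · e^{−δ₁∣x − y∣₁},
δ₁ = ½ min{δ₀, κ(Md)⁻¹}. [cite: Balaban1987RG1, (4.36) p.290] -/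
theorem ineq436_latt (hd : 0 < d) {M : ℕ} (hM : 0 < M) {E2 : LDom d → Pt d → Pt d → ℝ} {CE κ δ₀ R : ℝ}
    {Box Outer : Set (Pt d)} (hCE : 0 ≤ CE) (hδ₀ : 0 < δ₀) (hκ₀ : kappa₀ (4 * 2 ^ d) (2 * d) ≤ κ / 4)
    (hE : (geomZ d M).KernelBound E2 CE κ δ₀) (hsep : ∀ x ∈ Box, ∀ q ∈ Outer, R ≤ l1 (x - q))
    {x : Pt d} (hx : x ∈ Box) (y : Pt d) :
    Summable (fun X : {X : LDom d // MeetsZ M Outer X} => E2 X.1 x y) ∧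
    |∑' X : {X : LDom d // MeetsZ M Outer X}, E2 X.1 x y| ≤
      CE * Real.exp (delta1 δ₀ κ ((M : ℝ) * d) * ((M : ℝ) * d) * 3) * K₀ (4 * 2 ^ d) (2 * d) * K₁ d (δ₀ / 4) *
        Real.exp (-(delta1 δ₀ κ ((M : ℝ) * d) / 2) * (R - (M : ℝ) * d * 3)) *
        Real.exp (-(delta1 δ₀ κ ((M : ℝ) * d)) * l1 (x - y)) := by
  have hκ : 0 ≤ κ := kappa_nonneg_of (by norm_num) hκ₀
  have hMd : (0 : ℝ) < (M : ℝ) * d := mul_pos (Nat.cast_pos.2 hM) (Nat.cast_pos.2 hd)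
  exact (geomZ d M).ineq436_of_volumeLeaf (ρ := fun x y => l1 (x - y)) hCE hδ₀.le hκ hMd (degreeLE_latt d)
    (volumeLeaf_latt d) hκ₀ hE (geomLeafZ hM) (cubeSumLeafZ hM (by linarith)) (farLeafZ hM hsep) hx y

/-- **(4.37) converges absolutely on 𝐃⁰_j of ℤᵈ and obeys (5.10) (ℓ¹ reading), every geometric leaf discharged**:
under the kernel bound with δ₀ > 0 and κ ≥ 2κ₀(4·2ᵈ, 2d), for all sites x, y the family X ↦ 𝐄²(X, x, y) over the whole
infinite class is summable and ∣Π(x, y)∣ = ∣Σ_{X∈𝐃⁰_j} 𝐄²(X, x, y)∣ ≤ C_E e^{3Mdδ₁} K₀(4·2ᵈ, 2d) K₁(d, δ₀/2)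
e^{−δ₁∣x − y∣₁}, δ₁ = ½ min{δ₀, κ(Md)⁻¹}. [cite: Balaban1987RG1, (4.37) p.291 and (5.10) p.293] -/
theorem twoPoint_latt (hd : 0 < d) {M : ℕ} (hM : 0 < M) {E2 : LDom d → Pt d → Pt d → ℝ} {CE κ δ₀ : ℝ}
    (hCE : 0 ≤ CE) (hδ₀ : 0 < δ₀) (hκ₀ : kappa₀ (4 * 2 ^ d) (2 * d) ≤ κ / 2)
    (hE : (geomZ d M).KernelBound E2 CE κ δ₀) (x y : Pt d) :
    Summable (fun X : LDom d => E2 X x y) ∧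
    |∑' X : LDom d, E2 X x y| ≤
      CE * Real.exp (delta1 δ₀ κ ((M : ℝ) * d) * ((M : ℝ) * d) * 3) * K₀ (4 * 2 ^ d) (2 * d) * K₁ d (δ₀ / 2) *
        Real.exp (-(delta1 δ₀ κ ((M : ℝ) * d)) * l1 (x - y)) := by
  have hκ : 0 ≤ κ := kappa_nonneg_of (by norm_num) hκ₀
  have hMd : (0 : ℝ) < (M : ℝ) * d := mul_pos (Nat.cast_pos.2 hM) (Nat.cast_pos.2 hd)
  exact (geomZ d M).twoPoint_delta1 (ρ := fun x y => l1 (x - y)) hCE (K₀_pos _ _).le hδ₀.le hκ hMd hE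
    (geomLeafZ hM) (cubeSumLeafZ hM (half_pos hδ₀)) (ineq126_latt d hκ₀) x y

/-- **(5.10) ON ℤᵈ in the lineage's typed form, DIRECTLY on the infinite lattice** (no window limit): under the kernel
bound with δ₀ > 0, κ ≥ 2κ₀(4·2ᵈ, 2d), the vacuum polarization Π(z) := Σ′_{X∈𝐃⁰_j} 𝐄²(X, 0, z) satisfies
`B12Sec2to5.Decay510 Π C δ₁` with C = C_E e^{3Mdδ₁} K₀(4·2ᵈ, 2d) K₁(d, δ₀/2), δ₁ = ½ min{δ₀, κ(Md)⁻¹}.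
[cite: Balaban1987RG1, (5.10) p.293] -/
theorem decay510_latt (hd : 0 < d) {M : ℕ} (hM : 0 < M) {E2 : LDom d → Pt d → Pt d → ℝ} {CE κ δ₀ : ℝ}
    (hCE : 0 ≤ CE) (hδ₀ : 0 < δ₀) (hκ₀ : kappa₀ (4 * 2 ^ d) (2 * d) ≤ κ / 2)
    (hE : (geomZ d M).KernelBound E2 CE κ δ₀) :
    Decay510 (fun z => ∑' X : LDom d, E2 X 0 z)
      (CE * Real.exp (delta1 δ₀ κ ((M : ℝ) * d) * ((M : ℝ) * d) * 3) * K₀ (4 * 2 ^ d) (2 * d) * K₁ d (δ₀ / 2))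
      (delta1 δ₀ κ ((M : ℝ) * d)) :=
  SiteGeometry.decay510_of_twoPoint (G := latt d) fun x y => by
    have h := (twoPoint_latt hd hM hCE hδ₀ hκ₀ hE x y).2
    rwa [l1_sub_comm] at h

/-- **(5.10) ON ℤᵈ FROM THE ANALYTIC LEAVES** — the whole chain with every geometric leaf and the Cauchy leaf
discharged: IF the terms 𝐄^{(j)}(X, ·) are analytic on the α₂-ball ((4.4)) and bounded there by E₀e^{−κd_j(X)}
((1.18)), the kernel is the real part of the mixed τ-derivative on the minimizer responses ((4.35)), the responses obey
‖h_X(x)‖ ≤ B₃e^{−δ₀dist₁(x,X)} (p.282), δ₀ > 0 and κ ≥ 2κ₀(4·2ᵈ, 2d), THEN (4.37) converges absolutely for all x, y and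
Π(z) = Σ′_X 𝐄²(X, 0, z) satisfies `Decay510 Π (4E₀α₂⁻²B₃² e^{3Mdδ₁} K₀ K₁(d, δ₀/2)) δ₁`, δ₁ = ½ min{δ₀, κ(Md)⁻¹} — on the
infinite lattice itself (cf. `B12Decay510Lattice.decay510_lattice`: windows + the limit (5.1)). [cite: Balaban1987RG1, (5.10) p.293] -/
theorem decay510_latt_of_analytic (hd : 0 < d) {M : ℕ} (hM : 0 < M) {W : Type*} [NormedAddCommGroup W]
    [NormedSpace ℂ W] (EX : LDom d → W → ℂ) (h : LDom d → Pt d → W) (E2 : LDom d → Pt d → Pt d → ℝ)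
    {α₂ E₀ B₃ κ δ₀ : ℝ} (hα₂ : 0 < α₂) (hE₀ : 0 ≤ E₀) (hB₃ : 0 ≤ B₃) (hδ₀ : 0 < δ₀)
    (hκ₀ : kappa₀ (4 * 2 ^ d) (2 * d) ≤ κ / 2)
    (han : ∀ X, AnalyticOnNhd ℂ (EX X) (ball 0 α₂))
    (h118 : ∀ X, ∀ v ∈ ball (0 : W) α₂, ‖EX X v‖ ≤ E₀ * Real.exp (-κ * treeLen X.1))
    (hrepr : ∀ X x y, E2 X x y = (mixedDeriv (EX X) (h X x) (h X y)).re)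
    (hh : ∀ X x, ‖h X x‖ ≤ B₃ * Real.exp (-δ₀ * (geomZ d M).distD x X)) :
    (∀ x y, Summable (fun X : LDom d => E2 X x y)) ∧
    Decay510 (fun z => ∑' X : LDom d, E2 X 0 z)
      (4 * E₀ / α₂ ^ 2 * B₃ ^ 2 * Real.exp (delta1 δ₀ κ ((M : ℝ) * d) * ((M : ℝ) * d) * 3) *
        K₀ (4 * 2 ^ d) (2 * d) * K₁ d (δ₀ / 2))
      (delta1 δ₀ κ ((M : ℝ) * d)) := by
  have hE : (geomZ d M).KernelBound E2 (4 * E₀ / α₂ ^ 2 * B₃ ^ 2) κ δ₀ :=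
    kernelBound_of_analytic (geomZ d M) EX h E2 hα₂ hE₀ hB₃ han h118 hrepr hh
  have hCE : 0 ≤ 4 * E₀ / α₂ ^ 2 * B₃ ^ 2 := by positivity
  exact ⟨fun x y => (twoPoint_latt hd hM hCE hδ₀ hκ₀ hE x y).1, decay510_latt hd hM hCE hδ₀ hκ₀ hE⟩

/-- **(4.36) ON ℤᵈ IN THE SUP READING — the printed δ₁**: with dist(x, X), dist(x, □), ∣x − y∣ all sup lattice
distances, cubes of side M ≥ 1, the kernel bound with δ₀ > 0, κ ≥ 4κ₀(4·2ᵈ, 2d), and R ≤ dist_∞(x, q) for x ∈ □,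
q ∈ (□̃²)ᶜ: for x ∈ □, ∣Σ_{X∩(□̃²)ᶜ≠∅} 𝐄²(X, x, y)∣ ≤ C_E e^{3Mδ₁} K₀(4·2ᵈ, 2d) K₁(d, δ₀/(4d)) e^{−(δ₁/2)(R − 3M)}
e^{−δ₁dist_∞(x,y)} with δ₁ = `delta1 δ₀ κ M` = ½ min{δ₀, κM⁻¹} (summability included). [cite: Balaban1987RG1, (4.36) p.290] -/
theorem ineq436_lattS (hd : 0 < d) {M : ℕ} (hM : 0 < M) {E2 : LDom d → Pt d → Pt d → ℝ} {CE κ δ₀ R : ℝ}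
    {Box Outer : Set (Pt d)} (hCE : 0 ≤ CE) (hδ₀ : 0 < δ₀) (hκ₀ : kappa₀ (4 * 2 ^ d) (2 * d) ≤ κ / 4)
    (hE : (geomZS d M).KernelBound E2 CE κ δ₀) (hsep : ∀ x ∈ Box, ∀ q ∈ Outer, R ≤ dist x q)
    {x : Pt d} (hx : x ∈ Box) (y : Pt d) :
    Summable (fun X : {X : LDom d // MeetsZ M Outer X} => E2 X.1 x y) ∧
    |∑' X : {X : LDom d // MeetsZ M Outer X}, E2 X.1 x y| ≤
      CE * Real.exp (delta1 δ₀ κ M * M * 3) * K₀ (4 * 2 ^ d) (2 * d) * K₁ d (δ₀ / 4 / d) *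
        Real.exp (-(delta1 δ₀ κ M / 2) * (R - (M : ℝ) * 3)) * Real.exp (-(delta1 δ₀ κ M) * dist x y) := by
  have hκ : 0 ≤ κ := kappa_nonneg_of (by norm_num) hκ₀
  have hMR : (0 : ℝ) < M := Nat.cast_pos.2 hM
  exact (geomZS d M).ineq436_of_volumeLeaf (ρ := dist) hCE hδ₀.le hκ hMR (degreeLE_latt d)
    (volumeLeaf_latt d) hκ₀ hE (geomLeafZS hM) (cubeSumLeafZS hd hM (by linarith)) (farLeafZS hM hsep) hx y

/-- **(4.36) on ℤᵈ in the PRINTED SHAPE** «≤ O(1)E₀ exp(−(L^jη)^{−1}) exp(−δ₁∣x − y∣), for x ∈ □» (sup reading): with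
T := (L^jη)^{−1}, whenever T ≤ (δ₁/2)(R − 3M) the bound is (C_E e^{3Mδ₁} K₀ K₁) · e^{−T} · e^{−δ₁dist_∞(x,y)},
δ₁ = ½ min{δ₀, κM⁻¹}. [cite: Balaban1987RG1, (4.36) p.290] -/
theorem ineq436_lattS_printed (hd : 0 < d) {M : ℕ} (hM : 0 < M) {E2 : LDom d → Pt d → Pt d → ℝ}
    {CE κ δ₀ R T : ℝ} {Box Outer : Set (Pt d)} (hCE : 0 ≤ CE) (hδ₀ : 0 < δ₀)
    (hκ₀ : kappa₀ (4 * 2 ^ d) (2 * d) ≤ κ / 4) (hE : (geomZS d M).KernelBound E2 CE κ δ₀)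
    (hsep : ∀ x ∈ Box, ∀ q ∈ Outer, R ≤ dist x q) (hT : T ≤ delta1 δ₀ κ M / 2 * (R - (M : ℝ) * 3))
    {x : Pt d} (hx : x ∈ Box) (y : Pt d) :
    |∑' X : {X : LDom d // MeetsZ M Outer X}, E2 X.1 x y| ≤
      CE * Real.exp (delta1 δ₀ κ M * M * 3) * K₀ (4 * 2 ^ d) (2 * d) * K₁ d (δ₀ / 4 / d) * Real.exp (-T) *
        Real.exp (-(delta1 δ₀ κ M) * dist x y) := by
  have hκ : 0 ≤ κ := kappa_nonneg_of (by norm_num) hκ₀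
  have hMR : (0 : ℝ) < M := Nat.cast_pos.2 hM
  exact (geomZS d M).ineq436_printed (ρ := dist) hCE (K₀_pos _ _).le hδ₀.le hκ hMR hE (geomLeafZS hM)
    (cubeSumLeafZS hd hM (by linarith)) (ineq126_latt d hκ₀) (farLeafZS hM hsep) hT hx y

/-- **(4.37)/(5.10) on 𝐃⁰_j of ℤᵈ in the SUP READING — the printed constant on the nose**: under the kernel bound (sup
distances) with δ₀ > 0, κ ≥ 2κ₀(4·2ᵈ, 2d): Σ_X 𝐄²(X, x, y) converges absolutely and ∣Π(x, y)∣ ≤ C_E e^{3Mδ₁}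
K₀(4·2ᵈ, 2d) K₁(d, δ₀/(2d)) e^{−δ₁dist_∞(x,y)} with δ₁ = `delta1 δ₀ κ M` = ½ min{δ₀, κM⁻¹} — p.293 *"(e.g., δ₁ =
1/2min{δ₀, κM⁻¹})"* literally. [cite: Balaban1987RG1, (4.37) p.291 and (5.10) p.293] -/
theorem twoPoint_lattS (hd : 0 < d) {M : ℕ} (hM : 0 < M) {E2 : LDom d → Pt d → Pt d → ℝ} {CE κ δ₀ : ℝ}
    (hCE : 0 ≤ CE) (hδ₀ : 0 < δ₀) (hκ₀ : kappa₀ (4 * 2 ^ d) (2 * d) ≤ κ / 2)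
    (hE : (geomZS d M).KernelBound E2 CE κ δ₀) (x y : Pt d) :
    Summable (fun X : LDom d => E2 X x y) ∧
    |∑' X : LDom d, E2 X x y| ≤
      CE * Real.exp (delta1 δ₀ κ M * M * 3) * K₀ (4 * 2 ^ d) (2 * d) * K₁ d (δ₀ / 2 / d) *
        Real.exp (-(delta1 δ₀ κ M) * dist x y) := by
  have hκ : 0 ≤ κ := kappa_nonneg_of (by norm_num) hκ₀
  have hMR : (0 : ℝ) < M := Nat.cast_pos.2 hM
  exact (geomZS d M).twoPoint_delta1 (ρ := dist) hCE (K₀_pos _ _).le hδ₀.le hκ hMR hE (geomLeafZS hM)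
    (cubeSumLeafZS hd hM (half_pos hδ₀)) (ineq126_latt d hκ₀) x y

end Literature.MathematicalPhysics.QuantumFieldTheory.Balaban1983to89.B12Ext436Lattice
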